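import Summits.AnomalousDissipation.AnomalousDissipation.Theorems.MomentParityPathField
import Summits.AnomalousDissipation.AnomalousDissipation.Theorems.MomentParityTimeAverages
import Literature.Analysis.FluidPDE.StatisticalSolutionEnergyEq
import Literature.Analysis.FluidPDE.WeakSolution
import Literature.Analysis.FluidPDE.NSHopfGalerkin
import Literature.Analysis.FluidPDE.CylindricalGenerator
import Literature.Analysis.ODE.LipschitzFlow
import Literature.Analysis.ODE.LiouvilleInvariantMeasure
import Summits.AnomalousDissipation.AnomalousDissipation.Theorems.StirringSphereEnsembleRealizationStubAugCurrentPair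
import Summits.AnomalousDissipation.AnomalousDissipation.Theorems.StirringSphereEnsembleRealizationStubAugCurrentLevelCurrent
import Summits.AnomalousDissipation.AnomalousDissipation.Theorems.StirringSphereEnsembleRealizationStubAugCurrentLevelMarg
import Summits.AnomalousDissipation.AnomalousDissipation.Theorems.StirringSphereEnsembleRealizationStubAugCurrentLevelDrift
import Summits.AnomalousDissipation.AnomalousDissipation.Theorems.StirringSphereEnsembleRealizationStubAugCurrentLevelEnergy
import Summits.AnomalousDissipation.AnomalousDissipation.Theorems.StirringSphereEnsembleRealizationStubAugCurrentLevelBasis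

/-!
# Crux `EnsembleRealization` (stmt-AnomalousDissipation-0215) — line `augmented-lift`,
# sub-stub (M1a) `stub_augCurrentLevelPairs`: the stationary smooth level pairs of the augmented current (PROVED)

Supports stmt-AnomalousDissipation-0215 (registered stub `stub_augCurrentLevelPairs`, the last open piece of the
reshaped mechanism stub `stub_augCurrent` → `stub_augmentedLaw` → `stub_augmentedLift` of line `augmented-lift`).
Assembly of the landed pieces: (L1) `stub_augCurrentLevelBasisTools` (band basis + completeness + rate),
(L3) `stub_augCurrentLevelCurrentTools` (the smooth compactly supported divergence-free current built from the
Foias–Prodi measure and the cylindrically weighted energy inequalities `CEI`), (L4) `stub_augCurrentPairTools`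
(the stationary pair `(m, V)`), and the three links MARG / DRIFT / ENERGY (`stub_augCurrentLevelMargTools`,
`stub_augCurrentLevelDriftTools`, `stub_augCurrentLevelEnergyTools`, composed here as `augCurrentLevel_linkTools`).
Level schedule: `N_n = n`, `δ_n = ε_n = 1/(n+2)`, `θ_n = R/(R+δ_n)`, `Bx n = closedBall 0 (R+δ_n) ×ˢ Icc 0 (R²+δ_n)`.
-/

noncomputable section

set_option linter.dupNamespace false

open MeasureTheory Set Filter Topology Function Metric UnitAddTorus
open scoped BigOperators ENNReal InnerProductSpace RealInnerProductSpace

namespace Summit.AnomalousDissipation.AnomalousDissipation.Theorems.EnsembleRealization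

open Literature.Analysis.FunctionSpaces Literature.Analysis.FunctionSpaces.Torus
open Literature.Analysis.FluidPDE Literature.Analysis.FluidPDE.Torus
open Summit.AnomalousDissipation.AnomalousDissipation.Theorems.MomentParity

variable {ν : ℝ} {f : UnitAddTorus (Fin 3) → EuclideanSpace ℝ (Fin 3)}
  {μ : Measure (Torus.energySpace (Fin 3))}

/-- **(L5) Link tools**, composed from MARG (proved), DRIFT, ENERGY. -/
theorem augCurrentLevel_linkTools {ν : ℝ} {f : UnitAddTorus (Fin 3) → EuclideanSpace ℝ (Fin 3)}
    {μ : Measure (Torus.energySpace (Fin 3))} (hν : 0 < ν) (hf : IsSmooth f) (hμ : IsStationaryStatisticalSolution ν f μ)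
    {R : ℝ} (hR : ∀ᵐ u ∂μ, ‖u‖ ≤ R) (hR0 : 0 ≤ R)
    (D : ℕ → ℕ) (g : (n : ℕ) → Fin (D n) → UnitAddTorus (Fin 3) → EuclideanSpace ℝ (Fin 3))
    (N : ℕ → ℕ) (δ ε c θ : ℕ → ℝ)
    (ρ₁ : (n : ℕ) → EuclideanSpace ℝ (Fin (D n)) → ℝ) (ρ₂ : ℕ → ℝ → ℝ)
    (p₁ : (n : ℕ) → EuclideanSpace ℝ (Fin (D n)) × ℝ → ℝ)
    (J V : (n : ℕ) → EuclideanSpace ℝ (Fin (D n)) × ℝ → EuclideanSpace ℝ (Fin (D n)) × ℝ)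
    (m : (n : ℕ) → Measure (EuclideanSpace ℝ (Fin (D n)) × ℝ))
    (hN : Tendsto N atTop atTop) (hδ : ∀ n, 0 < δ n ∧ δ n ≤ 1) (hδ0 : Tendsto δ atTop (𝓝 0))
    (hε : ∀ n, 0 < ε n ∧ ε n < 1) (hε0 : Tendsto ε atTop (𝓝 0))
    (hθ : ∀ n, θ n = R / (R + δ n))
    (hg : ∀ n j, IsSmooth (g n j))
    (horth : ∀ n i j, ∫ x, ⟪g n i x, g n j x⟫_ℝ = if i = j then 1 else 0)
    (hgH : ∀ n (u : Torus.energySpace (Fin 3)) x, ∑ j, pairing u.1 (g n j) • g n j x =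
      fourierTruncate (N n) (u.1 : UnitAddTorus (Fin 3) → EuclideanSpace ℝ (Fin 3)) x)
    (hgA : ∀ n (a : UnitAddTorus (Fin 3) → EuclideanSpace ℝ (Fin 3)), IsSmooth a → IsDivFree a → HasZeroMean a →
      ∀ x, ∑ j, (∫ y, ⟪a y, g n j y⟫_ℝ) • g n j x = fourierTruncate (N n) a x)
    (hρ₁ : ∀ n, Continuous (ρ₁ n) ∧ (∀ y, 0 ≤ ρ₁ n y) ∧ (∀ y, δ n ≤ ‖y‖ → ρ₁ n y = 0) ∧ ∫ y, ρ₁ n y = 1)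
    (hρ₂ : ∀ n, Continuous (ρ₂ n) ∧ (∀ s, 0 ≤ ρ₂ n s) ∧ (∀ s, s ∉ Ioo 0 (δ n) → ρ₂ n s = 0) ∧ ∫ s, ρ₂ n s = 1)
    (hp : ∀ n, Continuous (p₁ n)) (hp0 : ∀ n z, 0 ≤ p₁ n z)
    (hpB : ∀ n z, z ∉ closedBall (0 : EuclideanSpace ℝ (Fin (D n))) (R + δ n) ×ˢ Icc 0 (R ^ 2 + δ n) → p₁ n z = 0)
    (hp1 : ∀ n, ∫ z, p₁ n z ∂((volume : Measure (EuclideanSpace ℝ (Fin (D n)))).prod (volume : Measure ℝ)) = 1)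
    (hpZ : ∀ n (z : EuclideanSpace ℝ (Fin (D n)) × ℝ),
      p₁ n z = ∫ u, ρ₁ n (z.1 - WithLp.toLp 2 fun j => pairing u.1 (g n j)) * ρ₂ n (z.2 - ‖u‖ ^ 2) ∂μ)
    (hJc : ∀ n, Continuous (J n))
    (hJw : ∀ n z j, (J n z).1 j = ∫ u, ρ₁ n (z.1 - WithLp.toLp 2 fun j => pairing u.1 (g n j)) * ρ₂ n (z.2 - ‖u‖ ^ 2) *
      nsGeneratorPairing ν f u (g n j) ∂μ)
    (hJi : ∀ n (z : EuclideanSpace ℝ (Fin (D n)) × ℝ), Integrable (fun u : Torus.energySpace (Fin 3) =>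
      ρ₁ n (z.1 - WithLp.toLp 2 fun j => pairing u.1 (g n j)) * ρ₂ n (z.2 - ‖u‖ ^ 2) *
        (ν * (eGradNormSq (u.1 : UnitAddTorus (Fin 3) → EuclideanSpace ℝ (Fin 3))).toReal - pairing u.1 f)) μ)
    (hJe : ∀ n z, (J n z).2 + 2 * ∫ u, ρ₁ n (z.1 - WithLp.toLp 2 fun j => pairing u.1 (g n j)) * ρ₂ n (z.2 - ‖u‖ ^ 2) *
        (ν * (eGradNormSq (u.1 : UnitAddTorus (Fin 3) → EuclideanSpace ℝ (Fin 3))).toReal - pairing u.1 f) ∂μ ≤ 0)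
    (hq : ∀ n z, 0 < (1 - ε n) * p₁ n z + ε n * c n)
    (hV : ∀ n z, V n z = ((1 - ε n) / ((1 - ε n) * p₁ n z + ε n * c n)) • J n z)
    (hm : ∀ n, IsProbabilityMeasure (m n))
    (htr : ∀ n (G : EuclideanSpace ℝ (Fin (D n)) × ℝ → ℝ), Continuous G →
      ∫ z, G z ∂(m n) = (1 - ε n) * ∫ z, G z * p₁ n z ∂((volume : Measure (EuclideanSpace ℝ (Fin (D n)))).prod (volume : Measure ℝ)) +
        ε n * c n * ∫ z in closedBall (0 : EuclideanSpace ℝ (Fin (D n))) (R + δ n) ×ˢ Icc 0 (R ^ 2 + δ n), G z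
          ∂((volume : Measure (EuclideanSpace ℝ (Fin (D n)))).prod (volume : Measure ℝ))) :
    (∀ φ : ((Fin 3 → ℤ) → EuclideanSpace ℂ (Fin 3)) × ℝ → ℝ, Continuous φ →
        (∃ B : ℝ, ∀ z, |φ z| ≤ B) →
        Tendsto (fun n => ∫ z, φ ((fun k : Fin 3 → ℤ =>
            mFourierCoeff (EuclideanSpace.complexify ∘ fun x => θ n • ∑ j, z.1 j • g n j x) k), z.2) ∂(m n)) atTop
          (𝓝 (∫ u, φ ((fun k : Fin 3 → ℤ => mFourierCoeff (EuclideanSpace.complexify ∘ (u.1 : UnitAddTorus (Fin 3) → EuclideanSpace ℝ (Fin 3))) k), ‖u‖ ^ 2) ∂μ))) ∧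
      (∀ a : UnitAddTorus (Fin 3) → EuclideanSpace ℝ (Fin 3), IsSmooth a → IsDivFree a → HasZeroMean a →
        ∀ c : ((Fin 3 → ℤ) → EuclideanSpace ℂ (Fin 3)) → ℝ, Continuous c → (∃ B : ℝ, ∀ z, |c z| ≤ B) →
        ∀ γ : ℝ, 0 < γ → ∀ᶠ n in atTop,
          ∫ z, |(∫ x, ⟪a x, θ n • ∑ j, (V n z).1 j • g n j x⟫_ℝ) -
              c (fun k : Fin 3 → ℤ => mFourierCoeff (EuclideanSpace.complexify ∘ fun x => θ n • ∑ j, z.1 j • g n j x) k)| ∂(m n) ≤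
            (∫ u, |nsGeneratorPairing ν f u a - c (fun k : Fin 3 → ℤ => mFourierCoeff (EuclideanSpace.complexify ∘ (u.1 : UnitAddTorus (Fin 3) → EuclideanSpace ℝ (Fin 3))) k)| ∂μ) + γ) ∧
      (∀ (K : ℕ) (γ : ℝ), 0 < γ → ∀ᶠ n in atTop,
        ∫ z, max 0 ((V n z).2 +
            2 * (ν * (4 * Real.pi ^ 2 * ∑ k ∈ freqBall K, freqNormSq k *
              ‖mFourierCoeff (EuclideanSpace.complexify ∘ fun x => θ n • ∑ j, z.1 j • g n j x) k‖ ^ 2)) -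
            2 * ∫ x, ⟪f x, θ n • ∑ j, z.1 j • g n j x⟫_ℝ) ∂(m n) ≤ γ) :=
  ⟨stub_augCurrentLevelMargTools hμ hR hR0 D g N δ ε c θ ρ₁ ρ₂ p₁ m hN (fun n => (hδ n).1) hδ0 hε hε0 hθ hg horth
      hgH hρ₁ hρ₂ hp1 hpZ hm htr,
    stub_augCurrentLevelDriftTools hf hμ hR hR0 D g N δ ε c θ ρ₁ ρ₂ p₁ J V m hN hδ hδ0 hε hε0 hθ hg
      horth hgH hgA hρ₁ hρ₂ hp hp0 hpB hp1 hpZ hJc hJw hq hV hm htr,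
    stub_augCurrentLevelEnergyTools hν hf hμ hR hR0 D g N δ ε c θ ρ₁ ρ₂ p₁ J V m hN hδ hδ0 hε hε0 hθ hg
      horth hgH hρ₁ hρ₂ hp hp0 hpB hp1 hpZ hJc hJi hJe hq hV hm htr⟩


/-- **(M1a) The stationary smooth level pairs of the augmented current** (pure
finite-dimensional calculus + `CEI`; see the section docstring). -/
theorem stub_augCurrentLevelPairs (hν : 0 < ν) (hf : IsSmooth f) (hμ : IsStationaryStatisticalSolution ν f μ)
    (hcei : (∀ (m : ℕ) (g : Fin m → UnitAddTorus (Fin 3) → EuclideanSpace ℝ (Fin 3)),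
      (∀ j, IsSmooth (g j)) → (∀ j, IsDivFree (g j)) → (∀ j, HasZeroMean (g j)) →
      ∀ ψ : EuclideanSpace ℝ (Fin m) × ℝ → ℝ, ContDiff ℝ 1 ψ →
        (∃ C : ℝ, ∀ z, |ψ z| ≤ C ∧ ‖fderiv ℝ ψ z‖ ≤ C) →
        (∀ ξ : EuclideanSpace ℝ (Fin m), Monotone fun e : ℝ => ψ (ξ, e)) →
        Integrable (fun u : Torus.energySpace (Fin 3) =>
            fderiv ℝ ψ (WithLp.toLp 2 fun j => pairing u.1 (g j), ‖u‖ ^ 2) (0, 1) *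
              (ν * (eGradNormSq (u.1 : UnitAddTorus (Fin 3) → EuclideanSpace ℝ (Fin 3))).toReal - pairing u.1 f)) μ ∧
        Integrable (fun u : Torus.energySpace (Fin 3) =>
            nsGeneratorPairing ν f u (fun x => ∑ j, fderiv ℝ ψ (WithLp.toLp 2 fun j => pairing u.1 (g j), ‖u‖ ^ 2)
              (EuclideanSpace.single j 1, 0) • g j x)) μ ∧
        2 * ∫ u, fderiv ℝ ψ (WithLp.toLp 2 fun j => pairing u.1 (g j), ‖u‖ ^ 2) (0, 1) *
              (ν * (eGradNormSq (u.1 : UnitAddTorus (Fin 3) → EuclideanSpace ℝ (Fin 3))).toReal - pairing u.1 f) ∂μ ≤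
          ∫ u, nsGeneratorPairing ν f u (fun x => ∑ j, fderiv ℝ ψ (WithLp.toLp 2 fun j => pairing u.1 (g j), ‖u‖ ^ 2)
              (EuclideanSpace.single j 1, 0) • g j x) ∂μ))
    {R : ℝ} (hR : ∀ᵐ u ∂μ, ‖u‖ ≤ R) :
    ∃ (D : ℕ → ℕ) (g : (n : ℕ) → Fin (D n) → UnitAddTorus (Fin 3) → EuclideanSpace ℝ (Fin 3))
      (θ : ℕ → ℝ) (Bx : (n : ℕ) → Set (EuclideanSpace ℝ (Fin (D n)) × ℝ))
      (m : (n : ℕ) → Measure (EuclideanSpace ℝ (Fin (D n)) × ℝ))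
      (V : (n : ℕ) → EuclideanSpace ℝ (Fin (D n)) × ℝ → EuclideanSpace ℝ (Fin (D n)) × ℝ),
      (∀ n, (∀ j, IsSmooth (g n j)) ∧ (∀ j, IsDivFree (g n j)) ∧
        (∀ i j, ∫ x, ⟪g n i x, g n j x⟫_ℝ = if i = j then 1 else 0) ∧
        0 ≤ θ n ∧ IsCompact (Bx n) ∧ (∀ z ∈ Bx n, θ n * ‖z.1‖ ≤ R) ∧
        (∀ z ∈ Bx n, 0 ≤ z.2 ∧ z.2 ≤ R ^ 2 + 1) ∧
        IsProbabilityMeasure (m n) ∧ m n (Bx n)ᶜ = 0 ∧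
        ContDiff ℝ 1 (V n) ∧ HasCompactSupport (V n) ∧ tsupport (V n) ⊆ Bx n ∧
        (∀ ψ : EuclideanSpace ℝ (Fin (D n)) × ℝ → ℝ, ContDiff ℝ 1 ψ → HasCompactSupport ψ →
          ∫ z, fderiv ℝ ψ z (V n z) ∂(m n) = 0) ∧
        (∀ z k, ‖mFourierCoeff (EuclideanSpace.complexify ∘ fun x => θ n • ∑ j, (V n z).1 j • g n j x) k‖ ≤
          pathLip ν (∫ x, ‖f x‖) R k)) ∧
      (∀ φ : ((Fin 3 → ℤ) → EuclideanSpace ℂ (Fin 3)) × ℝ → ℝ, Continuous φ →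
        (∃ B : ℝ, ∀ z, |φ z| ≤ B) →
        Tendsto (fun n => ∫ z, φ ((fun k : Fin 3 → ℤ =>
            mFourierCoeff (EuclideanSpace.complexify ∘ fun x => θ n • ∑ j, z.1 j • g n j x) k), z.2) ∂(m n)) atTop
          (𝓝 (∫ u, φ ((fun k : Fin 3 → ℤ => mFourierCoeff (EuclideanSpace.complexify ∘ (u.1 : UnitAddTorus (Fin 3) → EuclideanSpace ℝ (Fin 3))) k), ‖u‖ ^ 2) ∂μ))) ∧
      (∀ a : UnitAddTorus (Fin 3) → EuclideanSpace ℝ (Fin 3), IsSmooth a → IsDivFree a → HasZeroMean a →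
        ∀ c : ((Fin 3 → ℤ) → EuclideanSpace ℂ (Fin 3)) → ℝ, Continuous c → (∃ B : ℝ, ∀ z, |c z| ≤ B) →
        ∀ γ : ℝ, 0 < γ → ∀ᶠ n in atTop,
          ∫ z, |(∫ x, ⟪a x, θ n • ∑ j, (V n z).1 j • g n j x⟫_ℝ) -
              c (fun k : Fin 3 → ℤ => mFourierCoeff (EuclideanSpace.complexify ∘ fun x => θ n • ∑ j, z.1 j • g n j x) k)| ∂(m n) ≤
            (∫ u, |nsGeneratorPairing ν f u a - c (fun k : Fin 3 → ℤ => mFourierCoeff (EuclideanSpace.complexify ∘ (u.1 : UnitAddTorus (Fin 3) → EuclideanSpace ℝ (Fin 3))) k)| ∂μ) + γ) ∧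
      (∀ (K : ℕ) (γ : ℝ), 0 < γ → ∀ᶠ n in atTop,
        ∫ z, max 0 ((V n z).2 +
            2 * (ν * (4 * Real.pi ^ 2 * ∑ k ∈ freqBall K, freqNormSq k *
              ‖mFourierCoeff (EuclideanSpace.complexify ∘ fun x => θ n • ∑ j, z.1 j • g n j x) k‖ ^ 2)) -
            2 * ∫ x, ⟪f x, θ n • ∑ j, z.1 j • g n j x⟫_ℝ) ∂(m n) ≤ γ) := by
  haveI := hμ.prob
  rcases lt_or_ge R 0 with hRneg | hR0
  · -- `R < 0`: the a.e. ball is empty, contradicting `μ(H) = 1`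
    exfalso
    have hfalse : ∀ᵐ u ∂μ, False := hR.mono fun u hu => by linarith [norm_nonneg u]
    exact IsProbabilityMeasure.ne_zero μ (ae_eq_bot.1 (Filter.eventually_false_iff_eq_bot.1 hfalse))
  -- level parameters `N_n = n`, `δ_n = ε_n = 1/(n+2)`, `θ_n = R/(R + δ_n)`
  set δ : ℕ → ℝ := fun n => 1 / ((n : ℝ) + 2) with hδdef
  have hδpos : ∀ n, 0 < δ n := fun n => by rw [hδdef]; positivity
  have hδlt : ∀ n, δ n < 1 := fun n => by
    rw [hδdef]; dsimp only; rw [div_lt_one (by positivity)]; linarith [(Nat.cast_nonneg n : (0 : ℝ) ≤ n)]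
  have hδ0 : Tendsto δ atTop (𝓝 0) :=
    tendsto_const_nhds.div_atTop (tendsto_atTop_add_const_right _ _ tendsto_natCast_atTop_atTop)
  have hA : 0 ≤ ∫ x, ‖f x‖ := integral_nonneg fun _ => norm_nonneg _
  have hL0 : ∀ k : Fin 3 → ℤ, 0 ≤ pathLip ν (∫ x, ‖f x‖) R k - 1 := fun k => by
    have h1 : 0 ≤ |ν| * (4 * Real.pi ^ 2 * freqNormSq k) * |R| := by
      have := freqNormSq_nonneg k; positivity
    have h2 : 0 ≤ 2 * Real.pi * Real.sqrt (freqNormSq k) * R ^ 2 := by positivity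
    rw [pathLip]; linarith
  -- (L1) the bases, (L3) the currents, (A4) the pairs
  choose D g hg hgdiv hg0 horth hgN hgH hgA hgB hrate using
    fun n : ℕ => stub_augCurrentLevelBasisTools ν hf hR0 n
  choose ρ₁ ρ₂ J p₁ hρ₁ hρ₂ hJ hJB hdiv hp hp0 hpB hp1 hpZ hJw hJi hJe hJr using fun n : ℕ =>
    stub_augCurrentLevelCurrentTools hf hμ hcei hR (hg n) (hgdiv n) (hg0 n) (hgB n) (hrate n) (hδpos n)
  have hBxc : ∀ n, IsCompact (closedBall (0 : EuclideanSpace ℝ (Fin (D n))) (R + δ n) ×ˢ Icc 0 (R ^ 2 + δ n)) :=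
    fun n => (isCompact_closedBall _ _).prod isCompact_Icc
  have hBx0 : ∀ n, ((volume : Measure (EuclideanSpace ℝ (Fin (D n)))).prod (volume : Measure ℝ))
      (closedBall (0 : EuclideanSpace ℝ (Fin (D n))) (R + δ n) ×ˢ Icc 0 (R ^ 2 + δ n)) ≠ 0 := fun n => by
    rw [Measure.prod_prod]
    refine mul_ne_zero (measure_closedBall_pos volume _ (by linarith [hδpos n])).ne' ?_
    rw [Real.volume_Icc, Ne, ENNReal.ofReal_eq_zero, not_le]
    nlinarith [hδpos n, sq_nonneg R]
  choose c m V hc hq hV hprob hmB hVc hVcs hVB hliou htr using fun n : ℕ =>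
    stub_augCurrentPairTools (hBxc n) (hBx0 n) (hJ n) (hJB n) (hdiv n) (hp n) (hp0 n) (hpB n) (hp1 n)
      (hδpos n) (hδlt n)
  set θ : ℕ → ℝ := fun n => R / (R + δ n) with hθdef
  have hθ0 : ∀ n, 0 ≤ θ n := fun n => div_nonneg hR0 (by linarith [hδpos n])
  have hθ1 : ∀ n, θ n ≤ 1 := fun n => by
    rw [hθdef]; dsimp only; rw [div_le_one (by linarith [hδpos n])]; linarith [hδpos n]
  -- the links (L5)
  obtain ⟨hmarg, hdrift, henergy⟩ := augCurrentLevel_linkTools hν hf hμ hR hR0 D g (fun n => n) δ δ c θ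
    ρ₁ ρ₂ p₁ J V m tendsto_id (fun n => ⟨hδpos n, (hδlt n).le⟩) hδ0 (fun n => ⟨hδpos n, hδlt n⟩) hδ0
    (fun n => rfl) hg horth hgH hgA hρ₁ hρ₂ (fun n => (hp n).continuous) hp0 hpB hp1 hpZ
    (fun n => (hJ n).continuous) hJw hJi hJe hq hV hprob htr
  refine ⟨D, g, θ, fun n => closedBall (0 : EuclideanSpace ℝ (Fin (D n))) (R + δ n) ×ˢ Icc 0 (R ^ 2 + δ n), m, V,
    fun n => ⟨hg n, hgdiv n, horth n, hθ0 n, hBxc n, fun z hz => ?_, fun z hz => ?_, hprob n, hmB n, hVc n,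
      hVcs n, hVB n, hliou n, fun z k => ?_⟩, hmarg, hdrift, henergy⟩
  · -- `θ ‖w‖ ≤ R` on the box
    have hz1 : ‖z.1‖ ≤ R + δ n := mem_closedBall_zero_iff.1 (Set.mem_prod.1 hz).1
    have hRδ : 0 < R + δ n := by linarith [hδpos n]
    calc θ n * ‖z.1‖ ≤ θ n * (R + δ n) := mul_le_mul_of_nonneg_left hz1 (hθ0 n)
      _ = R := by rw [hθdef]; dsimp only; rw [div_mul_cancel₀ _ hRδ.ne']
  · -- `0 ≤ e ≤ R² + 1` on the box
    have hz2 := (Set.mem_prod.1 hz).2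
    exact ⟨hz2.1, hz2.2.trans (by linarith [hδlt n])⟩
  · -- the modewise rate bound
    set r : ℝ := (1 - δ n) / ((1 - δ n) * p₁ n z + δ n * c n) with hrdef
    have hr0 : 0 ≤ r := div_nonneg (by linarith [hδlt n]) (hq n z).le
    have hrp : r * p₁ n z ≤ 1 := by
      rw [hrdef, div_mul_eq_mul_div, div_le_one (hq n z)]
      nlinarith [hp0 n z, (hc n).le, (hδpos n).le]
    have hVz : ∀ j, (V n z).1 j = r * (J n z).1 j := fun j => by rw [hV n z]; rfl
    have h1 : ∀ x, θ n • ∑ j, (V n z).1 j • g n j x = (θ n * r) • ∑ j, (J n z).1 j • g n j x := fun x => by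
      simp_rw [hVz, mul_smul, ← Finset.smul_sum]
    have hfun : (EuclideanSpace.complexify ∘ fun x => θ n • ∑ j, (V n z).1 j • g n j x) =
        fun x => (θ n * r) • (EuclideanSpace.complexify ∘ fun x => ∑ j, (J n z).1 j • g n j x) x := by
      funext x; simp only [Function.comp_apply, h1, map_smul]
    rw [hfun, mFourierCoeff_real_smul, norm_smul, Real.norm_eq_abs, abs_of_nonneg (mul_nonneg (hθ0 n) hr0)]
    calc θ n * r * ‖mFourierCoeff (EuclideanSpace.complexify ∘ fun x => ∑ j, (J n z).1 j • g n j x) k‖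
        ≤ θ n * r * ((pathLip ν (∫ x, ‖f x‖) R k - 1) * p₁ n z) :=
          mul_le_mul_of_nonneg_left (hJr n z k) (mul_nonneg (hθ0 n) hr0)
      _ = θ n * (r * p₁ n z) * (pathLip ν (∫ x, ‖f x‖) R k - 1) := by ring
      _ ≤ 1 * (pathLip ν (∫ x, ‖f x‖) R k - 1) :=
          mul_le_mul_of_nonneg_right (mul_le_one₀ (hθ1 n) (mul_nonneg hr0 (hp0 n z)) hrp) (hL0 k)
      _ ≤ pathLip ν (∫ x, ‖f x‖) R k := by linarith

end Summit.AnomalousDissipation.AnomalousDissipation.Theorems.EnsembleRealization
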